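import Literature.NumberTheory.EllipticCurves.Pal2012.QuadraticTwistPeriod
import Literature.NumberTheory.EllipticCurves.ImaginaryPeriod
import Literature.NumberTheory.EllipticCurves.QuadraticTwistKroneckerLFunctionProofs
import Literature.NumberTheory.EllipticCurves.QuadraticTwistLocalPolynomialTwoProofs
import Literature.NumberTheory.DiophantineGeometry.LocalReductionMinimalityProofs
import Literature.NumberTheory.DiophantineGeometry.LocalReductionHasMultiplicativeReductionAtProofs
import HarnessLib

/-!
# Pal 2012, Thm. 3.2 with Prop. 2.5 for `d = p ≡ 1 (mod 4)`, `E` semistable at `p` — PROVED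

Sibling *proofs* file (theorems only, no definitions, no named facts) of
`Literature.NumberTheory.EllipticCurves.Pal2012.QuadraticTwistPeriod`, DISCHARGING its named fact
`Pal2012.thm32_sqrt_mul_realPeriodRat_twist_eq_of_prime_one_mod_four`
(`…_holds` at the end of this file): for `V/ℚ` globally minimal with good or multiplicative
reduction at a prime `p ≡ 1 (mod 4)` and `W` any globally minimal model of the quadratic twist
`V^{(p)}` (`C • V.quadraticTwist p = W`), the real periods (all real components) satisfy
`√p · Ω(W) = Ω(V)` — V. Pal, *Periods of quadratic twists of elliptic curves*, Proc. AMS 140 (2012),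
Thm. 3.2 ("if `d > 0`, then `Ω(E^d) = (ũ/√d) Ω(E)`") with Prop. 2.5 (`u_p = 1` since
`λ_{v_p}(E) = 0 < 6` at a semistable `p`; `u₂ = 1` since `d ≡ 1 (mod 4)`; `u_ℓ = 1` at odd `ℓ ∤ d`),
i.e. `ũ = 1`.

## Proof (following Pal, §§2–3, in the tree's vocabulary)

* **Archimedean step** (`WeierstrassCurve.realPeriod_quadraticTwist_mul_sqrt_of_pos`, Pal Lemma 3.1
  for the model itself): for `W` over `ℝ` and `D > 0` the period lattice of the model
  `W^{(D)} = (0, D b₂/4, 0, D² b₄/2, D³ b₆/4)` (`c₄ ↦ D² c₄`, `c₆ ↦ D³ c₆`) is `(1/√D)·Λ_W`, a real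
  lattice with the same number of real components, so `Ω(W^{(D)}) · √D = Ω(W)`. Over `ℚ`, for ANY
  model `Wd = C • V^{(d)}` of the twist (`d > 0`): `Ω(Wd) · √d = |u(C)| · Ω(V)`
  (`realPeriodRat_mul_sqrt_of_twist_of_pos`; `Ω(C • X) = |u| Ω(X)`, Silverman *AEC* III.1 Table 3.1).
  This is the `d > 0` twin of `realPeriodRat_mul_sqrt_of_twist_of_neg` (`ImaginaryPeriod.lean`).
* **Non-archimedean step** (Pal Prop. 2.4–2.5 = Connell's computation of `ũ`, here `ũ = |u(C)| = 1`):
  at every finite place `v` of `ℚ` the scaling `u(C)` between the twisted equation and the globally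
  minimal `W` is a `v`-unit, because at each `v` SOME `v`-minimal equation of `E^{(p)}` differs from
  `V^{(p)}` by a change of variables with `u = 1`, and two `v`-minimal equations differ by a `v`-unit
  (Silverman *AEC* VII.1 Prop. 1.3(b); `valuation_eq_one_of_isMinimal_smul_adicCompletion`):
  - `v ∤ 2p`: `p` and `2` are `v`-units and the unit twist of the `v`-minimal `V` is `v`-minimal
    (tree: `isMinimal_quadraticTwist`, twisting back);
  - `v ∣ 2`: `p = 1 + 4c` and the `2`-integral equation
    `(a₁, c a₁² + p a₂, p a₃, 2pc a₁a₃ + p² a₄, p²c a₃² + p³ a₆)` of the twist (Connell; tree: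
    `smul_baseChange_twistLiftTwo`, change of variables `(1, 0, −a₁/2, −p a₃/2)`) is `v`-minimal
    (tree: `isMinimal_baseChange_twistLiftTwo`, twisting back) — this is Pal's `u₂ = 1` for
    `d ≡ 1 (mod 4)`;
  - `v ∣ p`: `V^{(p)}` is `v`-integral with `v(Δ) = 6 < 12` (good `V`) or `v(c₄) = 2 < 4`
    (multiplicative `V`), hence `v`-minimal (Silverman VII.1 Remark 1.1) — Pal's `u_p = 1` for
    `λ_{v_p} < 6`.
  Hence `u(C) ∈ ℤ` and `u(C)⁻¹ ∈ ℤ`, `u(C) = ±1` (`u_eq_one_or_eq_neg_one_of_smul_quadraticTwist`).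

Motivation: BSD rank-`≤ 1` residual cell `b2b-bsdres`, sub-cell additive-p4, chain V9 link [E]
(`Summits/BirchSwinnertonDyer/Rank1Residual/Additive/SemistableTwistAnalytic.lean`,
`…/X3RankZeroSemistableTwist.lean` take the fact as the binder `hPal`, now dischargeable by
`…_holds`).

## References
* V. Pal, *Periods of quadratic twists of elliptic curves*, Proc. Amer. Math. Soc. 140 (2012)
  1513–1525 (= arXiv:1012.0094): Lemma 2.2, Prop. 2.4, Prop. 2.5, Lemma 3.1, Thm. 3.2. [Pal2012]
* J. H. Silverman, *The Arithmetic of Elliptic Curves*, 2nd ed. (2009): III.1 Table 3.1, VII.1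
  Prop. 1.3(b) and Remark 1.1, VIII.8, X.5 Cor. 5.4. [SilvermanAEC2009]
* J. E. Cremona, *Algorithms for Modular Elliptic Curves*, 2nd ed. (1997), §3.7. [CremonaAlgorithms1997]

## Design notes
Theorems only; deliberate dot-notation extensions of Mathlib's `WeierstrassCurve` namespace for the
period and local lemmas (as in `ImaginaryPeriod.lean`, `GlobalMinimalModel.lean`), and the discharge
in the fact's namespace `Literature.NumberTheory.EllipticCurves.Pal2012`.
-/

noncomputable section

open scoped Classical

open Complex NumberField IsDedekindDomain IsDedekindDomain.HeightOneSpectrum Rat.HeightOneSpectrum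
  IsLocalRing IsDiscreteValuationRing

namespace WeierstrassCurve

/-! ## The archimedean step: `Ω(W^{(D)}) · √D = Ω(W)` for `D > 0` -/

section Real

variable (W : WeierstrassCurve ℝ) [W.IsElliptic]

/-- **Pal 2012, Lemma 3.1 / Thm. 3.2, case `d > 0`, for the twisted model over `ℝ` (PROVED).** For an
elliptic curve `W` over `ℝ` and `D > 0`: `Ω(W^{(D)}) · √D = Ω(W)`, where
`W^{(D)} = W.quadraticTwist D` (`c₄ ↦ D²c₄`, `c₆ ↦ D³c₆`) and `Ω = realPeriod = ∫_{E(ℝ)}|ω|` (all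
real components) — Pal's "if `d > 0`, then `Ω(E^d) = (ũ/√d) Ω(E)`" for the model `W^{(D)}` itself
(`ũ = 1`). Proof: the period lattice of `W^{(D)}` is `(1/√D)·Λ` (`g₂(cΛ) = c⁻⁴g₂`, `g₃(cΛ) = c⁻⁶g₃`
with `c² = 1/D`), whose least positive real period is `Ω₀(W)/√D`, and both curves have the same
number of real components (`Δ(W^{(D)}) = D⁶Δ`). [cite: Pal2012, Lemma 3.1 and Thm. 3.2 (case d > 0)]
[cite: CremonaAlgorithms1997, §3.7] -/
theorem realPeriod_quadraticTwist_mul_sqrt_of_pos {D : ℝ} (hD : 0 < D) :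
    (W.quadraticTwist D).realPeriod * Real.sqrt D = W.realPeriod := by
  have hD0 : D ≠ 0 := hD.ne'
  haveI : (W.quadraticTwist D).IsElliptic := W.isElliptic_quadraticTwist hD0
  obtain ⟨L, h₂, h₃, -⟩ := W.exists_periodPair_realPeriod_eq_holds
  -- the period lattice of the twist: `(1/√D) · Λ`
  set t : ℝ := (Real.sqrt D)⁻¹ with ht
  have hsqrt : 0 < Real.sqrt D := Real.sqrt_pos.mpr hD
  have htpos : 0 < t := inv_pos.mpr hsqrt
  have ht2 : t ^ 2 = D⁻¹ := by rw [ht, inv_pow, Real.sq_sqrt hD.le]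
  have ht2C : (t : ℂ) ^ 2 = ((D : ℝ) : ℂ)⁻¹ := by exact_mod_cast ht2
  have ht4 : ((t : ℂ) ^ 4)⁻¹ = (D : ℂ) ^ 2 := by
    rw [show (t : ℂ) ^ 4 = ((t : ℂ) ^ 2) ^ 2 by ring, ht2C, inv_pow, inv_inv]
  have ht6 : ((t : ℂ) ^ 6)⁻¹ = (D : ℂ) ^ 3 := by
    rw [show (t : ℂ) ^ 6 = ((t : ℂ) ^ 2) ^ 3 by ring, ht2C, inv_pow, inv_inv]
  have htC : (t : ℂ) ≠ 0 := by exact_mod_cast htpos.ne'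
  set LD := L.mulLeft (t : ℂ) htC with hLD
  have hLD₂ : LD.g₂ = (((W.quadraticTwist D).c₄ / 12 : ℝ) : ℂ) := by
    rw [hLD, PeriodPair.g₂_mulLeft, h₂, ht4, quadraticTwist_c₄]
    push_cast; ring
  have hLD₃ : LD.g₃ = (((W.quadraticTwist D).c₆ / 216 : ℝ) : ℂ) := by
    rw [hLD, PeriodPair.g₃_mulLeft, h₃, ht6, quadraticTwist_c₆]
    push_cast; ring
  have hΩD : (W.quadraticTwist D).realPeriod =
      (W.quadraticTwist D).numRealComponents * (t * L.minRealPeriod) := by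
    rw [(W.quadraticTwist D).realPeriod_eq_numRealComponents_mul_minRealPeriod hLD₂ hLD₃]
    congr 1
    exact L.minRealPeriod_mulLeft_ofReal htpos
  rw [hΩD, W.numRealComponents_quadraticTwist hD0,
    W.realPeriod_eq_numRealComponents_mul_minRealPeriod h₂ h₃, ht]
  field_simp

end Real

/-! ## Over `ℚ`: `Ω(C • V^{(d)}) · √d = |u(C)| · Ω(V)` for `d > 0` -/

section Rat

variable (V : WeierstrassCurve ℚ) [V.IsElliptic]

/-- **Pal 2012, Thm. 3.2, case `d > 0`, over `ℚ` with Pal's rational factor `ũ` made EXPLICIT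
(PROVED).** For `V/ℚ` elliptic, `d > 0`, and ANY model `Wd = C • V^{(d)}` of the twist over `ℚ`
(e.g. a globally minimal model of `E^d`; `V^{(d)} = V.quadraticTwist d`):
`Ω(Wd) · √d = |u(C)| · Ω(V)` with `Ω = realPeriodRat = ∫|ω|` over all real components — Pal's
"`Ω(E^d) = (ũ/√d) Ω(E)`", his `ũ` being this `|u|` when `V` and `Wd` are minimal (twin of
`realPeriodRat_mul_sqrt_of_twist_of_neg`). From `realPeriod_quadraticTwist_mul_sqrt_of_pos` and
`Ω(C • X) = |u| Ω(X)` (`realPeriodRat_smul_holds`).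
[cite: Pal2012, Thm. 3.2 (case d > 0)] [cite: SilvermanAEC2009, §III.1 Table 3.1] -/
theorem realPeriodRat_mul_sqrt_of_twist_of_pos {d : ℚ} (hd : 0 < d) (Wd : WeierstrassCurve ℚ)
    (C : VariableChange ℚ) (hC : C • V.quadraticTwist d = Wd) :
    Wd.realPeriodRat * Real.sqrt (d : ℝ) = |((C.u : ℚ) : ℝ)| * V.realPeriodRat := by
  subst hC
  haveI : (V.baseChange ℝ).IsElliptic := by rw [baseChange]; infer_instance
  have hdR : (0 : ℝ) < d := by exact_mod_cast hd
  rw [(V.quadraticTwist d).realPeriodRat_smul_holds C, realPeriodRat_def,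
    V.baseChange_real_quadraticTwist, V.realPeriodRat_def, mul_assoc,
    (V.baseChange ℝ).realPeriod_quadraticTwist_mul_sqrt_of_pos hdR]

end Rat

/-! ## The non-archimedean step: `u(C)` is a unit at every finite place -/

section Local

/-- **Silverman VII.1.3(b) at a finite place of `ℚ`, for equations over the completion.** If `Y` and
`E • Y` are both `𝒪_v`-minimal Weierstrass equations over `ℚ_v` (`Δ(Y) ≠ 0`) and `u(E)` is (the
image of) a rational number `u`, then `u` is a `v`-unit: `u, u⁻¹ ∈ 𝒪_v`
(`exists_algebraMap_eq_u_of_isMinimal`). [cite: SilvermanAEC2009, VII.1 Prop. 1.3(b) (PDF p. 165)] -/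
theorem valuation_eq_one_of_isMinimal_smul_adicCompletion (v : HeightOneSpectrum (𝓞 ℚ))
    (Y : WeierstrassCurve (v.adicCompletion ℚ)) (hY : Y.Δ ≠ 0)
    [IsMinimal (v.adicCompletionIntegers ℚ) Y] (E : VariableChange (v.adicCompletion ℚ))
    [IsMinimal (v.adicCompletionIntegers ℚ) (E • Y)] {u : ℚ}
    (hu : (E.u : v.adicCompletion ℚ) = algebraMap ℚ (v.adicCompletion ℚ) u) :
    v.valuation ℚ u = 1 := by
  obtain ⟨⟨a, ha⟩, ⟨b, hb⟩⟩ :=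
    exists_algebraMap_eq_u_of_isMinimal (v.adicCompletionIntegers ℚ) Y E hY
  have hu0 : u ≠ 0 := by
    intro h
    rw [h, map_zero] at hu
    exact (Units.ne_zero E.u) hu
  have h1 : v.valuation ℚ u ≤ 1 := by
    have h := a.2
    rw [HeightOneSpectrum.mem_adicCompletionIntegers, ← ValuationSubring.algebraMap_apply, ha, hu,
      valued_algebraMap_adicCompletion] at h
    exact h
  have h2 : v.valuation ℚ u⁻¹ ≤ 1 := by
    have h := b.2
    rw [HeightOneSpectrum.mem_adicCompletionIntegers, ← ValuationSubring.algebraMap_apply, hb,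
      Units.val_inv_eq_inv_val, hu, ← map_inv₀, valued_algebraMap_adicCompletion] at h
    exact h
  rw [map_inv₀, inv_le_one₀ (zero_lt_iff.mpr ((Valuation.ne_zero_iff _).mpr hu0))] at h2
  exact le_antisymm h1 h2

variable (V : WeierstrassCurve ℚ) [V.IsElliptic] [V.IsGloballyMinimal]

/-- **`u(C)` is a `v`-unit at the odd places `v ∤ d`** (Pal 2012, Prop. 2.5: "`u_ℓ = 1` if `ℓ` is an
odd prime not dividing `d`"): for `V/ℚ` globally minimal, `d ∈ ℤ` and `v ∤ 2d`, the twisted equation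
`V^{(d)} ⊗ ℚ_v = (V ⊗ ℚ_v)^{(d)}` is the twist by a `v`-UNIT of a `v`-minimal equation, hence
`v`-minimal (`isMinimal_quadraticTwist`, twisting back); so for any globally minimal
`W = C • V^{(d)}` the scaling `u(C)` between two `v`-minimal equations is a `v`-unit.
[cite: Pal2012, Prop. 2.5 (odd ℓ ∤ d)] [cite: SilvermanAEC2009, VII.1 Prop. 1.3(b)] -/
theorem valuation_u_eq_one_of_smul_quadraticTwist_of_odd_of_not_dvd (v : HeightOneSpectrum (𝓞 ℚ))
    (hv2 : (primesEquiv v : ℕ) ≠ 2) {d : ℤ} (hvd : ¬ ((primesEquiv v : ℕ) : ℤ) ∣ d)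
    (W : WeierstrassCurve ℚ) [W.IsGloballyMinimal] (C : VariableChange ℚ)
    (hC : C • V.quadraticTwist (d : ℚ) = W) : v.valuation ℚ (C.u : ℚ) = 1 := by
  haveI := Fact.mk (primesEquiv v).2
  haveI : NeZero (2 : v.adicCompletion ℚ) := ⟨by
    rw [← map_ofNat (algebraMap ℚ (v.adicCompletion ℚ)) 2]; exact (map_ne_zero _).mpr two_ne_zero⟩
  have hℓp : (primesEquiv v : ℕ).Prime := (primesEquiv v).2
  have hℓ2 : ¬ ((primesEquiv v : ℕ) : ℤ) ∣ 2 := by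
    intro h
    exact hv2 ((Nat.prime_dvd_prime_iff_eq hℓp Nat.prime_two).mp (Int.natCast_dvd_natCast.mp h))
  have hd0 : d ≠ 0 := by
    rintro rfl
    exact hvd (dvd_zero _)
  have hdq : (d : ℚ) ≠ 0 := by exact_mod_cast hd0
  haveI := V.isElliptic_quadraticTwist hdq
  have hu := isUnit_adicCompletionIntegers_intCast v hvd
  have h2 : IsUnit (2 : v.adicCompletionIntegers ℚ) := by
    have := isUnit_adicCompletionIntegers_intCast v hℓ2
    simpa using this
  -- `V ⊗ ℚ_v` is `𝒪_v`-minimal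
  haveI hX : (V.baseChange (v.adicCompletion ℚ)).IsMinimal (v.adicCompletionIntegers ℚ) :=
    IsGloballyMinimal.isMinimal v
  -- the twist at `v` is the unit twist of `V ⊗ ℚ_v`, hence minimal
  have htw : (V.quadraticTwist (d : ℚ)).baseChange (v.adicCompletion ℚ) =
      (V.baseChange (v.adicCompletion ℚ)).quadraticTwist
        (algebraMap (v.adicCompletionIntegers ℚ) (v.adicCompletion ℚ) hu.unit) := by
    rw [baseChange, map_quadraticTwist, IsUnit.unit_spec, algebraMap_adicCompletionIntegers_intCast]
    rfl
  haveI hY : ((V.quadraticTwist (d : ℚ)).baseChange (v.adicCompletion ℚ)).IsMinimal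
      (v.adicCompletionIntegers ℚ) := by
    rw [htw]
    exact isMinimal_quadraticTwist (v.adicCompletionIntegers ℚ) _ h2 hu.unit
  haveI hE : ((C.baseChange (v.adicCompletion ℚ)) •
      (V.quadraticTwist (d : ℚ)).baseChange (v.adicCompletion ℚ)).IsMinimal
      (v.adicCompletionIntegers ℚ) := by
    rw [VariableChange.baseChange, baseChange, map_variableChange, hC]
    exact IsGloballyMinimal.isMinimal v
  have hΔ : ((V.quadraticTwist (d : ℚ)).baseChange (v.adicCompletion ℚ)).Δ ≠ 0 := by
    rw [baseChange, map_Δ]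
    exact (map_ne_zero _).mpr (V.quadraticTwist (d : ℚ)).isUnit_Δ.ne_zero
  exact valuation_eq_one_of_isMinimal_smul_adicCompletion v _ hΔ (C.baseChange (v.adicCompletion ℚ))
    (by rw [VariableChange.baseChange, VariableChange.map_u, Units.coe_map, MonoidHom.coe_coe])

/-- **`u(C)` is a unit at the place over `2` when `d ≡ 1 (mod 4)`** (Pal 2012, Prop. 2.5: "if
`d ≡ 1 mod 4`, then `u₂ = 1`"; Connell): with `d = 1 + 4c`, the `2`-INTEGRAL equation
`(a₁, c a₁² + d a₂, d a₃, 2dc a₁a₃ + d² a₄, d²c a₃² + d³ a₆)` of the twist of the `2`-minimal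
`V = (aᵢ)` — carried to `V^{(d)}` by the change of variables `(1, 0, −a₁/2, −d a₃/2)`
(`smul_baseChange_twistLiftTwo`) — is `2`-minimal (`isMinimal_baseChange_twistLiftTwo`, twisting
back), so for any globally minimal `W = C • V^{(d)}` the scaling `u(C) = u(C) · 1` between two
`2`-minimal equations is a `2`-adic unit. [cite: Pal2012, Prop. 2.5 (p = 2, d ≡ 1 mod 4) and Prop. 2.4]
[cite: SilvermanAEC2009, VII.1 Prop. 1.3(b)] -/
theorem valuation_u_eq_one_of_smul_quadraticTwist_two_of_emod_four_eq_one
    (v : HeightOneSpectrum (𝓞 ℚ)) (hv2 : (primesEquiv v : ℕ) = 2) {d : ℤ} (hd4 : d % 4 = 1)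
    (W : WeierstrassCurve ℚ) [W.IsGloballyMinimal] (C : VariableChange ℚ)
    (hC : C • V.quadraticTwist (d : ℚ) = W) : v.valuation ℚ (C.u : ℚ) = 1 := by
  haveI := Fact.mk (primesEquiv v).2
  haveI : NeZero (2 : v.adicCompletion ℚ) := ⟨by
    rw [← map_ofNat (algebraMap ℚ (v.adicCompletion ℚ)) 2]; exact (map_ne_zero _).mpr two_ne_zero⟩
  set c : ℤ := (d - 1) / 4 with hcdef
  have hdc : d = 1 + 4 * c := by omega
  -- `2 ∈ 𝔪_v`
  have hk : residue _ (2 : v.adicCompletionIntegers ℚ) = 0 := by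
    have := residue_adicCompletionIntegers_intCast_eq_zero v (n := 2) (by rw [hv2]; norm_num)
    simpa using this
  -- `V ⊗ ℚ_v` is `𝒪_v`-minimal (hence integral)
  haveI hX : (V.baseChange (v.adicCompletion ℚ)).IsMinimal (v.adicCompletionIntegers ℚ) :=
    IsGloballyMinimal.isMinimal v
  -- the twist at `v`
  have htw : (V.quadraticTwist (d : ℚ)).baseChange (v.adicCompletion ℚ) =
      (V.baseChange (v.adicCompletion ℚ)).quadraticTwist
        (algebraMap (v.adicCompletionIntegers ℚ) (v.adicCompletion ℚ)
          (1 + 4 * (c : v.adicCompletionIntegers ℚ))) := by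
    rw [baseChange, map_quadraticTwist, show (1 + 4 * (c : v.adicCompletionIntegers ℚ)) =
      ((1 + 4 * c : ℤ) : v.adicCompletionIntegers ℚ) by push_cast; ring, ← hdc,
      algebraMap_adicCompletionIntegers_intCast]
    rfl
  -- the `2`-integral, `2`-minimal equation `T` of the twist, with `S • T = V^{(d)} ⊗ ℚ_v`, `u(S) = 1`
  obtain ⟨T, hST, hT, hTΔ⟩ : ∃ T : WeierstrassCurve (v.adicCompletionIntegers ℚ),
      (⟨1, 0, -(V.baseChange (v.adicCompletion ℚ)).a₁ / 2,
          -(algebraMap (v.adicCompletionIntegers ℚ) (v.adicCompletion ℚ)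
              (1 + 4 * (c : v.adicCompletionIntegers ℚ))) *
            (V.baseChange (v.adicCompletion ℚ)).a₃ / 2⟩ : VariableChange (v.adicCompletion ℚ)) •
          T.baseChange (v.adicCompletion ℚ) =
        (V.baseChange (v.adicCompletion ℚ)).quadraticTwist
          (algebraMap (v.adicCompletionIntegers ℚ) (v.adicCompletion ℚ)
            (1 + 4 * (c : v.adicCompletionIntegers ℚ))) ∧
      IsMinimal (v.adicCompletionIntegers ℚ) (T.baseChange (v.adicCompletion ℚ)) ∧
      (T.baseChange (v.adicCompletion ℚ)).Δ =
        algebraMap (v.adicCompletionIntegers ℚ) (v.adicCompletion ℚ)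
          (1 + 4 * (c : v.adicCompletionIntegers ℚ)) ^ 6 * (V.baseChange (v.adicCompletion ℚ)).Δ :=
    ⟨_, smul_baseChange_twistLiftTwo (v.adicCompletionIntegers ℚ) _ (c : v.adicCompletionIntegers ℚ),
      isMinimal_baseChange_twistLiftTwo (v.adicCompletionIntegers ℚ) hk _
        (c : v.adicCompletionIntegers ℚ),
      Δ_baseChange_twistLiftTwo (v.adicCompletionIntegers ℚ) _ (c : v.adicCompletionIntegers ℚ)⟩
  haveI := hT
  set S : VariableChange (v.adicCompletion ℚ) :=
    ⟨1, 0, -(V.baseChange (v.adicCompletion ℚ)).a₁ / 2,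
      -(algebraMap (v.adicCompletionIntegers ℚ) (v.adicCompletion ℚ)
          (1 + 4 * (c : v.adicCompletionIntegers ℚ))) *
        (V.baseChange (v.adicCompletion ℚ)).a₃ / 2⟩ with hSdef
  -- `W ⊗ ℚ_v = C • V^{(d)} ⊗ ℚ_v = (C * S) • T` is minimal
  haveI hE : ((C.baseChange (v.adicCompletion ℚ) * S) • T.baseChange (v.adicCompletion ℚ)).IsMinimal
      (v.adicCompletionIntegers ℚ) := by
    rw [mul_smul, hST, ← htw, VariableChange.baseChange, baseChange, map_variableChange, hC]
    exact IsGloballyMinimal.isMinimal v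
  have hd0 : algebraMap (v.adicCompletionIntegers ℚ) (v.adicCompletion ℚ)
      (1 + 4 * (c : v.adicCompletionIntegers ℚ)) ≠ 0 :=
    (map_ne_zero_iff _ (IsFractionRing.injective (v.adicCompletionIntegers ℚ) (v.adicCompletion ℚ))).mpr
      (isUnit_one_add_four_mul (v.adicCompletionIntegers ℚ) hk _).ne_zero
  have hΔ : (T.baseChange (v.adicCompletion ℚ)).Δ ≠ 0 := by
    rw [hTΔ]
    refine mul_ne_zero (pow_ne_zero _ hd0) ?_
    rw [baseChange, map_Δ]
    exact (map_ne_zero _).mpr V.isUnit_Δ.ne_zero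
  have hCS : (C.baseChange (v.adicCompletion ℚ) * S).u = (C.baseChange (v.adicCompletion ℚ)).u := by
    rw [VariableChange.mul_def]
    exact mul_one _
  exact valuation_eq_one_of_isMinimal_smul_adicCompletion v _ hΔ (C.baseChange (v.adicCompletion ℚ) * S)
    (by rw [hCS, VariableChange.baseChange, VariableChange.map_u, Units.coe_map, MonoidHom.coe_coe])

/-- **The twisted equation `V^{(p)}` is minimal at the place over `p` when `V` is semistable at the
odd prime `p`** (Pal 2012, Prop. 2.5: `u_p = 1` when `λ_{v_p} = min(3v(c₄), 2v(c₆), v(Δ)) < 6`):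
for `V/ℚ` globally minimal, the equation `y² = x³ + p(b₂/4)x² + p²(b₄/2)x + p³(b₆/4)` is
`v`-integral (`v(2) = v(4) = 1`), and `v(Δ) = v(p⁶Δ(V)) = 6 < 12` if `V` has good reduction at `p`,
resp. `v(c₄) = v(p²c₄(V)) = 2 < 4` if `V` has multiplicative reduction at `p`; an integral equation
with `v(Δ) < 12` or `v(c₄) < 4` is minimal (Silverman VII.1 Remark 1.1).
[cite: Pal2012, Prop. 2.5 (odd p ∣ d, λ < 6)] [cite: SilvermanAEC2009, VII.1 Remark 1.1] -/
theorem isMinimalAt_quadraticTwist_of_semistable (v : HeightOneSpectrum (𝓞 ℚ)) (p : ℕ)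
    [Fact p.Prime] (hvp : (primesEquiv v : ℕ) = p) (hp2 : p ≠ 2)
    (hV : V.HasGoodReductionAtPrime p ∨ V.HasMultiplicativeReductionAtPrime p) :
    (V.quadraticTwist (p : ℚ)).IsMinimalAt v := by
  subst hvp
  have hpP : ((primesEquiv v : Nat.Primes) : ℕ).Prime := (primesEquiv v).2
  have hpZ : Prime (((primesEquiv v : Nat.Primes) : ℕ) : ℤ) := Nat.prime_iff_prime_int.mp hpP
  have hp2' : ¬ (((primesEquiv v : Nat.Primes) : ℕ) : ℤ) ∣ 2 := fun h =>
    hp2 ((Nat.prime_dvd_prime_iff_eq hpP Nat.prime_two).mp (Int.natCast_dvd_natCast.mp h))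
  have hp4 : ¬ (((primesEquiv v : Nat.Primes) : ℕ) : ℤ) ∣ 4 := fun h =>
    (hpZ.dvd_or_dvd (show (((primesEquiv v : Nat.Primes) : ℕ) : ℤ) ∣ 2 * 2 by norm_num; exact h)).elim
      hp2' hp2'
  have hVmin : V.IsMinimalAt v := IsGloballyMinimal.isMinimal v
  -- integrality of the coefficients of `V`
  set M : WeierstrassCurve ℤ := integralModelInt V with hM
  have hVM : M.map (Int.castRingHom ℚ) = V := map_integralModelInt V
  have hVb₂ : V.b₂ = (M.b₂ : ℚ) := by rw [← congrArg WeierstrassCurve.b₂ hVM, map_b₂, eq_intCast]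
  have hVb₄ : V.b₄ = (M.b₄ : ℚ) := by rw [← congrArg WeierstrassCurve.b₄ hVM, map_b₄, eq_intCast]
  have hVb₆ : V.b₆ = (M.b₆ : ℚ) := by rw [← congrArg WeierstrassCurve.b₆ hVM, map_b₆, eq_intCast]
  have hVc₄ : V.c₄ = (M.c₄ : ℚ) := by rw [← congrArg WeierstrassCurve.c₄ hVM, map_c₄, eq_intCast]
  have hv4 : v.valuation ℚ (4 : ℚ) = 1 := by
    have h := valuation_ringOfIntegers_intCast_eq_one v (n := 4) (by exact_mod_cast hp4)
    simpa using h
  have hv2 : v.valuation ℚ (2 : ℚ) = 1 := by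
    have h := valuation_ringOfIntegers_intCast_eq_one v (n := 2) (by exact_mod_cast hp2')
    simpa using h
  have hvp : v.valuation ℚ (((primesEquiv v : Nat.Primes) : ℕ) : ℚ) = WithZero.exp (-1 : ℤ) :=
    valuation_ringOfIntegers_natCast_primesEquiv v
  have hvb₂ : v.valuation ℚ V.b₂ ≤ 1 := hVb₂ ▸ valuation_ringOfIntegers_intCast_le_one v _
  have hvb₄ : v.valuation ℚ V.b₄ ≤ 1 := hVb₄ ▸ valuation_ringOfIntegers_intCast_le_one v _
  have hvb₆ : v.valuation ℚ V.b₆ ≤ 1 := hVb₆ ▸ valuation_ringOfIntegers_intCast_le_one v _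
  have he1 : WithZero.exp (-1 : ℤ) ≤ 1 := by
    rw [← WithZero.exp_zero]; exact WithZero.exp_le_exp.mpr (by norm_num)
  set X : WeierstrassCurve ℚ := V.quadraticTwist (((primesEquiv v : Nat.Primes) : ℕ) : ℚ) with hXdef
  -- the twisted equation is `v`-integral
  have hXint : X.IsIntegralAt v := by
    refine X.isIntegralAt_of_valuation_le_one v ?_ ?_ ?_ ?_ ?_
    · simp [hXdef]
    · simp only [hXdef, quadraticTwist_a₂, map_div₀, map_mul, hv4, hvp, div_one]
      exact mul_le_one' he1 hvb₂
    · simp [hXdef]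
    · simp only [hXdef, quadraticTwist_a₄, map_div₀, map_mul, map_pow, hv2, hvp, div_one]
      exact mul_le_one' (pow_le_one' he1 2) hvb₄
    · simp only [hXdef, quadraticTwist_a₆, map_div₀, map_mul, map_pow, hv4, hvp, div_one]
      exact mul_le_one' (pow_le_one' he1 3) hvb₆
  rcases hV with hgood | hmult
  · -- good reduction: `v(Δ(X)) = 6 < 12`
    have hVv : V.HasGoodReductionAt v :=
      (hasGoodReductionAtPrime_iff_hasGoodReductionAt_ringOfIntegers v V).mp hgood
    have hvΔ : v.valuation ℚ V.Δ = 1 := (hasGoodReductionAt_iff_of_isMinimalAt hVmin).mp hVv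
    have hΔ : v.valuation ℚ X.Δ = WithZero.exp (-6 : ℤ) := by
      rw [hXdef, quadraticTwist_Δ, map_mul, map_pow, hvp, hvΔ, mul_one, ← WithZero.exp_nsmul]
      norm_num
    exact isMinimalAt_of_lt_valuation_Δ_holds hXint
      (by rw [hΔ]; exact WithZero.exp_lt_exp.mpr (by norm_num))
  · -- multiplicative reduction: `v(c₄(X)) = 2 < 4`
    have hVv : V.HasMultiplicativeReductionAt v :=
      (V.hasMultiplicativeReductionAtPrime_iff_hasMultiplicativeReductionAt_ringOfIntegers v).mp hmult
    obtain ⟨-, hvc₄⟩ := (hasMultiplicativeReductionAt_iff_of_isMinimalAt hVmin).mp hVv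
    have hc₄ : v.valuation ℚ X.c₄ = WithZero.exp (-2 : ℤ) := by
      rw [hXdef, quadraticTwist_c₄, map_mul, map_pow, hvp, hvc₄, mul_one, ← WithZero.exp_nsmul]
      norm_num
    exact isMinimalAt_of_lt_valuation_c₄ hXint
      (by rw [hc₄]; exact WithZero.exp_lt_exp.mpr (by norm_num))

/-- **`u(C)` is a unit at the place over `p`** (Pal 2012, Prop. 2.5: `u_p = 1` at a semistable odd
`p ∣ d`): `V^{(p)}` and the globally minimal `W = C • V^{(p)}` are both `v`-minimal
(`isMinimalAt_quadraticTwist_of_semistable`), so `u(C)` is a `v`-unit (Silverman VII.1.3(b)).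
[cite: Pal2012, Prop. 2.5 (odd p ∣ d)] [cite: SilvermanAEC2009, VII.1 Prop. 1.3(b)] -/
theorem valuation_u_eq_one_of_smul_quadraticTwist_of_semistable (v : HeightOneSpectrum (𝓞 ℚ))
    (p : ℕ) [Fact p.Prime] (hvp : (primesEquiv v : ℕ) = p) (hp2 : p ≠ 2)
    (hV : V.HasGoodReductionAtPrime p ∨ V.HasMultiplicativeReductionAtPrime p)
    (W : WeierstrassCurve ℚ) [W.IsGloballyMinimal] (C : VariableChange ℚ)
    (hC : C • V.quadraticTwist (p : ℚ) = W) : v.valuation ℚ (C.u : ℚ) = 1 := by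
  have hp0 : (p : ℚ) ≠ 0 := by exact_mod_cast (Fact.out : p.Prime).ne_zero
  haveI := V.isElliptic_quadraticTwist hp0
  haveI hY : ((V.quadraticTwist (p : ℚ)).baseChange (v.adicCompletion ℚ)).IsMinimal
      (v.adicCompletionIntegers ℚ) :=
    V.isMinimalAt_quadraticTwist_of_semistable v p hvp hp2 hV
  haveI hE : ((C.baseChange (v.adicCompletion ℚ)) •
      (V.quadraticTwist (p : ℚ)).baseChange (v.adicCompletion ℚ)).IsMinimal
      (v.adicCompletionIntegers ℚ) := by
    rw [VariableChange.baseChange, baseChange, map_variableChange, hC]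
    exact IsGloballyMinimal.isMinimal v
  have hΔ : ((V.quadraticTwist (p : ℚ)).baseChange (v.adicCompletion ℚ)).Δ ≠ 0 := by
    rw [baseChange, map_Δ]
    exact (map_ne_zero _).mpr (V.quadraticTwist (p : ℚ)).isUnit_Δ.ne_zero
  exact valuation_eq_one_of_isMinimal_smul_adicCompletion v _ hΔ (C.baseChange (v.adicCompletion ℚ))
    (by rw [VariableChange.baseChange, VariableChange.map_u, Units.coe_map, MonoidHom.coe_coe])

/-- **Pal 2012, Prop. 2.5 in the case `d = p ≡ 1 (mod 4)`, `E` semistable at `p`: `ũ = 1`**, in the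
form: for `V/ℚ` globally minimal with good or multiplicative reduction at the prime `p ≡ 1 (mod 4)`
and ANY globally minimal model `W = C • V^{(p)}` of the twist, the scaling is `u(C) = ±1`. Indeed
`u(C)` is a unit at every finite place (`…_of_odd_of_not_dvd`, `…_two_of_emod_four_eq_one`,
`…_of_semistable`), so `u(C), u(C)⁻¹ ∈ 𝓞 ℚ = ℤ` (as in `isGloballyMinimal_unique_holds`).
[cite: Pal2012, Prop. 2.5 and Cor. 2.6] [cite: SilvermanAEC2009, VII.1 Prop. 1.3(b) and VIII.8] -/
theorem u_eq_one_or_eq_neg_one_of_smul_quadraticTwist (p : ℕ) [Fact p.Prime] (hp4 : p % 4 = 1)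
    (hV : V.HasGoodReductionAtPrime p ∨ V.HasMultiplicativeReductionAtPrime p)
    (W : WeierstrassCurve ℚ) [W.IsGloballyMinimal] (C : VariableChange ℚ)
    (hC : C • V.quadraticTwist (p : ℚ) = W) : (C.u : ℚ) = 1 ∨ (C.u : ℚ) = -1 := by
  have hpP : p.Prime := Fact.out
  have hp2 : p ≠ 2 := by
    rintro rfl
    norm_num at hp4
  have hC' : C • V.quadraticTwist ((p : ℤ) : ℚ) = W := by rwa [Int.cast_natCast]
  have hall : ∀ v : HeightOneSpectrum (𝓞 ℚ), v.valuation ℚ (C.u : ℚ) = 1 := by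
    intro v
    by_cases hvp : (primesEquiv v : ℕ) = p
    · exact V.valuation_u_eq_one_of_smul_quadraticTwist_of_semistable v p hvp hp2 hV W C hC
    by_cases hv2 : (primesEquiv v : ℕ) = 2
    · exact V.valuation_u_eq_one_of_smul_quadraticTwist_two_of_emod_four_eq_one v hv2
        (d := (p : ℤ)) (by exact_mod_cast hp4) W C hC'
    · have hvd : ¬ ((primesEquiv v : ℕ) : ℤ) ∣ (p : ℤ) := fun h =>
        hvp ((Nat.prime_dvd_prime_iff_eq (primesEquiv v).2 hpP).mp (Int.natCast_dvd_natCast.mp h))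
      exact V.valuation_u_eq_one_of_smul_quadraticTwist_of_odd_of_not_dvd v hv2 hvd W C hC'
  -- `u` and `u⁻¹` are integers
  have hu : (C.u : ℚ) ∈ (algebraMap (𝓞 ℚ) ℚ).range :=
    HeightOneSpectrum.mem_integers_of_valuation_le_one ℚ (C.u : ℚ) (fun v => (hall v).le)
  have hui : (C.u : ℚ)⁻¹ ∈ (algebraMap (𝓞 ℚ) ℚ).range :=
    HeightOneSpectrum.mem_integers_of_valuation_le_one ℚ (C.u : ℚ)⁻¹
      (fun v => by rw [map_inv₀, hall v, inv_one])
  obtain ⟨y, hy⟩ := hu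
  obtain ⟨yi, hyi⟩ := hui
  obtain ⟨U, hU⟩ : ∃ n : ℤ, (n : ℚ) = C.u :=
    ⟨Rat.ringOfIntegersEquiv y, (Rat.ringOfIntegersEquiv_apply_coe y).trans hy⟩
  obtain ⟨Ui, hUi⟩ : ∃ n : ℤ, (n : ℚ) = (C.u : ℚ)⁻¹ :=
    ⟨Rat.ringOfIntegersEquiv yi, (Rat.ringOfIntegersEquiv_apply_coe yi).trans hyi⟩
  have hUU : Ui * U = 1 := by
    exact_mod_cast (show (Ui : ℚ) * U = 1 by rw [hU, hUi, inv_mul_cancel₀ (Units.ne_zero C.u)])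
  rcases Int.eq_one_or_neg_one_of_mul_eq_one' hUU with ⟨-, h⟩ | ⟨-, h⟩
  · left; rw [← hU, h]; simp
  · right; rw [← hU, h]; simp

end Local

end WeierstrassCurve

/-! ## The discharge -/

namespace Literature.NumberTheory.EllipticCurves.Pal2012

open WeierstrassCurve

/-- **Pal 2012, Thm. 3.2 + Prop. 2.5, case `d = p ≡ 1 (mod 4)`, `E` semistable at `p` — PROVED**
(discharge of `thm32_sqrt_mul_realPeriodRat_twist_eq_of_prime_one_mod_four`): for `V/ℚ` globally
minimal with good or multiplicative reduction at a prime `p ≡ 1 (mod 4)` and `W` a globally minimal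
model of `V^{(p)}` (`C • V.quadraticTwist p = W`), `√p · Ω(W) = Ω(V)`. Assembled from the
archimedean identity `Ω(W) · √p = |u(C)| · Ω(V)` (`realPeriodRat_mul_sqrt_of_twist_of_pos`) and
`u(C) = ±1` (`u_eq_one_or_eq_neg_one_of_smul_quadraticTwist`, Pal's `ũ = 1`).
[cite: Pal2012, Thm. 3.2 (p. 1519) with Prop. 2.5 (pp. 1516–1517)] -/
theorem thm32_sqrt_mul_realPeriodRat_twist_eq_of_prime_one_mod_four_holds :
    thm32_sqrt_mul_realPeriodRat_twist_eq_of_prime_one_mod_four := by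
  intro V W _ _ _ _ p _ hp4 hV hCW
  obtain ⟨C, hC⟩ := hCW
  have hp0 : (0 : ℚ) < p := by exact_mod_cast (Fact.out : p.Prime).pos
  have h1 := V.realPeriodRat_mul_sqrt_of_twist_of_pos hp0 W C hC
  have hu : |((C.u : ℚ) : ℝ)| = 1 := by
    rcases V.u_eq_one_or_eq_neg_one_of_smul_quadraticTwist p hp4 hV W C hC with h | h
    · rw [h]; simp
    · rw [h]; simp
  rw [hu, one_mul, Rat.cast_natCast, mul_comm] at h1
  exact h1

end Literature.NumberTheory.EllipticCurves.Pal2012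

/-! ## APPEND (lit g15, 2026-08-20): the general square-free `d ≡ 1 (mod 4)` and the case `d < 0`

Pal 2012, Prop. 2.5 / Cor. 2.6 in full generality for the "`ũ = 1`" configuration: `E` globally
minimal, `d ≡ 1 (mod 4)` square-free, and `E` SEMISTABLE at every (odd) prime dividing `d`
(`λ_{v_ℓ}(E) = min(3v(c₄), 2v(c₆), v(Δ)) = 0 < 6` there: `v(Δ) = 0` at a good prime, `v(c₄) = 0` at
a multiplicative one). Then `ũ = 1`, i.e. the scaling between the twisted equation `E^{(d)}` and any
globally minimal model of the twist is `±1`; with the archimedean identities this gives Pal's Thm. 3.2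
EXACTLY: `√d · Ω(E^d) = Ω(E)` for `d > 0` and `Ω(E^d) · √(−d) = c_∞(E^d) · |Ω⁻(E)|` for `d < 0`
(the latter through `realPeriodRat_mul_sqrt_of_twist_of_neg` of `ImaginaryPeriod.lean`). The prime
cases `d = p ≡ 1 (mod 4)` (above) and `d = p* = −p`, `p ≡ 3 (mod 4)` (below,
`Pal2012.realPeriodRat_mul_sqrt_eq_of_twist_neg_prime`) are what the BSD residual cell's V9 line
uses (`p* ≡ 1 mod 4` in both cases).
-/

namespace WeierstrassCurve

section General

variable (V : WeierstrassCurve ℚ) [V.IsElliptic] [V.IsGloballyMinimal]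

/-- **The twisted equation `V^{(d)}` is minimal at an odd place `v` with `ℓ_v ∥ d` where `V` is
semistable** (Pal 2012, Prop. 2.5: `u_ℓ = 1` at an odd `ℓ ∣ d` with `λ_{v_ℓ} < 6`): the equation
`y² = x³ + d(b₂/4)x² + d²(b₄/2)x + d³(b₆/4)` is `v`-integral (`v(2) = v(4) = 1`, `v(d) = 1`
additively) with `v(Δ) = v(d⁶Δ(V)) = 6 < 12` (good `V`) or `v(c₄) = v(d²c₄(V)) = 2 < 4`
(multiplicative `V`), hence minimal (Silverman VII.1 Remark 1.1). Place-level generalisation of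
`isMinimalAt_quadraticTwist_of_semistable` (`d = p`).
[cite: Pal2012, Prop. 2.5 (odd ℓ ∣ d, λ < 6)] [cite: SilvermanAEC2009, VII.1 Remark 1.1] -/
theorem isMinimalAt_quadraticTwist_of_semistable_of_dvd (v : HeightOneSpectrum (𝓞 ℚ))
    (hv2 : (primesEquiv v : ℕ) ≠ 2) {d : ℤ} (h1 : ((primesEquiv v : ℕ) : ℤ) ∣ d)
    (h2 : ¬ ((primesEquiv v : ℕ) : ℤ) ^ 2 ∣ d)
    (hV : V.HasGoodReductionAt v ∨ V.HasMultiplicativeReductionAt v) :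
    (V.quadraticTwist (d : ℚ)).IsMinimalAt v := by
  have hpP : ((primesEquiv v : Nat.Primes) : ℕ).Prime := (primesEquiv v).2
  have hpZ : Prime (((primesEquiv v : Nat.Primes) : ℕ) : ℤ) := Nat.prime_iff_prime_int.mp hpP
  have hp2' : ¬ (((primesEquiv v : Nat.Primes) : ℕ) : ℤ) ∣ 2 := fun h =>
    hv2 ((Nat.prime_dvd_prime_iff_eq hpP Nat.prime_two).mp (Int.natCast_dvd_natCast.mp h))
  have hp4 : ¬ (((primesEquiv v : Nat.Primes) : ℕ) : ℤ) ∣ 4 := fun h =>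
    (hpZ.dvd_or_dvd (show (((primesEquiv v : Nat.Primes) : ℕ) : ℤ) ∣ 2 * 2 by norm_num; exact h)).elim
      hp2' hp2'
  have hVmin : V.IsMinimalAt v := IsGloballyMinimal.isMinimal v
  -- integrality of the coefficients of `V`
  set M : WeierstrassCurve ℤ := integralModelInt V with hM
  have hVM : M.map (Int.castRingHom ℚ) = V := map_integralModelInt V
  have hVb₂ : V.b₂ = (M.b₂ : ℚ) := by rw [← congrArg WeierstrassCurve.b₂ hVM, map_b₂, eq_intCast]
  have hVb₄ : V.b₄ = (M.b₄ : ℚ) := by rw [← congrArg WeierstrassCurve.b₄ hVM, map_b₄, eq_intCast]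
  have hVb₆ : V.b₆ = (M.b₆ : ℚ) := by rw [← congrArg WeierstrassCurve.b₆ hVM, map_b₆, eq_intCast]
  have hv4 : v.valuation ℚ (4 : ℚ) = 1 := by
    have h := valuation_ringOfIntegers_intCast_eq_one v (n := 4) (by exact_mod_cast hp4)
    simpa using h
  have hv2' : v.valuation ℚ (2 : ℚ) = 1 := by
    have h := valuation_ringOfIntegers_intCast_eq_one v (n := 2) (by exact_mod_cast hp2')
    simpa using h
  have hvd : v.valuation ℚ (d : ℚ) = WithZero.exp (-1 : ℤ) :=
    valuation_ringOfIntegers_intCast_eq_exp_neg_one v h1 h2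
  have hvb₂ : v.valuation ℚ V.b₂ ≤ 1 := hVb₂ ▸ valuation_ringOfIntegers_intCast_le_one v _
  have hvb₄ : v.valuation ℚ V.b₄ ≤ 1 := hVb₄ ▸ valuation_ringOfIntegers_intCast_le_one v _
  have hvb₆ : v.valuation ℚ V.b₆ ≤ 1 := hVb₆ ▸ valuation_ringOfIntegers_intCast_le_one v _
  have he1 : WithZero.exp (-1 : ℤ) ≤ 1 := by
    rw [← WithZero.exp_zero]; exact WithZero.exp_le_exp.mpr (by norm_num)
  set X : WeierstrassCurve ℚ := V.quadraticTwist (d : ℚ) with hXdef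
  -- the twisted equation is `v`-integral
  have hXint : X.IsIntegralAt v := by
    refine X.isIntegralAt_of_valuation_le_one v ?_ ?_ ?_ ?_ ?_
    · simp [hXdef]
    · simp only [hXdef, quadraticTwist_a₂, map_div₀, map_mul, hv4, hvd, div_one]
      exact mul_le_one' he1 hvb₂
    · simp [hXdef]
    · simp only [hXdef, quadraticTwist_a₄, map_div₀, map_mul, map_pow, hv2', hvd, div_one]
      exact mul_le_one' (pow_le_one' he1 2) hvb₄
    · simp only [hXdef, quadraticTwist_a₆, map_div₀, map_mul, map_pow, hv4, hvd, div_one]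
      exact mul_le_one' (pow_le_one' he1 3) hvb₆
  rcases hV with hgood | hmult
  · -- good reduction: `v(Δ(X)) = 6 < 12`
    have hvΔ : v.valuation ℚ V.Δ = 1 := (hasGoodReductionAt_iff_of_isMinimalAt hVmin).mp hgood
    have hΔ : v.valuation ℚ X.Δ = WithZero.exp (-6 : ℤ) := by
      rw [hXdef, quadraticTwist_Δ, map_mul, map_pow, hvd, hvΔ, mul_one, ← WithZero.exp_nsmul]
      norm_num
    exact isMinimalAt_of_lt_valuation_Δ_holds hXint
      (by rw [hΔ]; exact WithZero.exp_lt_exp.mpr (by norm_num))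
  · -- multiplicative reduction: `v(c₄(X)) = 2 < 4`
    obtain ⟨-, hvc₄⟩ := (hasMultiplicativeReductionAt_iff_of_isMinimalAt hVmin).mp hmult
    have hc₄ : v.valuation ℚ X.c₄ = WithZero.exp (-2 : ℤ) := by
      rw [hXdef, quadraticTwist_c₄, map_mul, map_pow, hvd, hvc₄, mul_one, ← WithZero.exp_nsmul]
      norm_num
    exact isMinimalAt_of_lt_valuation_c₄ hXint
      (by rw [hc₄]; exact WithZero.exp_lt_exp.mpr (by norm_num))

/-- **`u(C)` is a unit at an odd place `v` with `ℓ_v ∥ d` where `V` is semistable** (Pal 2012,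
Prop. 2.5: `u_ℓ = 1`): `V^{(d)}` and the globally minimal `W = C • V^{(d)}` are both `v`-minimal
(`isMinimalAt_quadraticTwist_of_semistable_of_dvd`), so `u(C)` is a `v`-unit (Silverman VII.1.3(b)).
[cite: Pal2012, Prop. 2.5 (odd ℓ ∣ d)] [cite: SilvermanAEC2009, VII.1 Prop. 1.3(b)] -/
theorem valuation_u_eq_one_of_smul_quadraticTwist_of_semistable_of_dvd (v : HeightOneSpectrum (𝓞 ℚ))
    (hv2 : (primesEquiv v : ℕ) ≠ 2) {d : ℤ} (h1 : ((primesEquiv v : ℕ) : ℤ) ∣ d)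
    (h2 : ¬ ((primesEquiv v : ℕ) : ℤ) ^ 2 ∣ d)
    (hV : V.HasGoodReductionAt v ∨ V.HasMultiplicativeReductionAt v)
    (W : WeierstrassCurve ℚ) [W.IsGloballyMinimal] (C : VariableChange ℚ)
    (hC : C • V.quadraticTwist (d : ℚ) = W) : v.valuation ℚ (C.u : ℚ) = 1 := by
  have hd0 : d ≠ 0 := by
    rintro rfl
    exact h2 (dvd_zero _)
  have hdq : (d : ℚ) ≠ 0 := by exact_mod_cast hd0
  haveI := V.isElliptic_quadraticTwist hdq
  haveI hY : ((V.quadraticTwist (d : ℚ)).baseChange (v.adicCompletion ℚ)).IsMinimal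
      (v.adicCompletionIntegers ℚ) :=
    V.isMinimalAt_quadraticTwist_of_semistable_of_dvd v hv2 h1 h2 hV
  haveI hE : ((C.baseChange (v.adicCompletion ℚ)) •
      (V.quadraticTwist (d : ℚ)).baseChange (v.adicCompletion ℚ)).IsMinimal
      (v.adicCompletionIntegers ℚ) := by
    rw [VariableChange.baseChange, baseChange, map_variableChange, hC]
    exact IsGloballyMinimal.isMinimal v
  have hΔ : ((V.quadraticTwist (d : ℚ)).baseChange (v.adicCompletion ℚ)).Δ ≠ 0 := by
    rw [baseChange, map_Δ]
    exact (map_ne_zero _).mpr (V.quadraticTwist (d : ℚ)).isUnit_Δ.ne_zero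
  exact valuation_eq_one_of_isMinimal_smul_adicCompletion v _ hΔ (C.baseChange (v.adicCompletion ℚ))
    (by rw [VariableChange.baseChange, VariableChange.map_u, Units.coe_map, MonoidHom.coe_coe])

/-- **Pal 2012, Prop. 2.5 / Cor. 2.6: `ũ = 1` for a square-free `d ≡ 1 (mod 4)` at whose prime
divisors `E` is semistable** (`u₂ = 1` as `d ≡ 1 mod 4`; `u_ℓ = 1` at odd `ℓ ∤ d`; `u_ℓ = 1` at odd
`ℓ ∣ d` since `λ_{v_ℓ}(E) = 0 < 6` for `E` good or multiplicative at `ℓ`), in the form: for `V/ℚ`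
globally minimal and ANY globally minimal model `W = C • V^{(d)}` of the twist, `u(C) = ±1` — `u(C)`
is a unit at every finite place (`…_two_of_emod_four_eq_one`, `…_of_odd_of_not_dvd`,
`…_of_semistable_of_dvd`), hence `u(C), u(C)⁻¹ ∈ ℤ`.
[cite: Pal2012, Prop. 2.5 and Cor. 2.6] [cite: SilvermanAEC2009, VII.1 Prop. 1.3(b) and VIII.8] -/
theorem u_eq_one_or_eq_neg_one_of_smul_quadraticTwist_of_squarefree {d : ℤ} (hd4 : d % 4 = 1)
    (hsq : Squarefree d)
    (hV : ∀ v : HeightOneSpectrum (𝓞 ℚ), ((primesEquiv v : ℕ) : ℤ) ∣ d →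
      V.HasGoodReductionAt v ∨ V.HasMultiplicativeReductionAt v)
    (W : WeierstrassCurve ℚ) [W.IsGloballyMinimal] (C : VariableChange ℚ)
    (hC : C • V.quadraticTwist (d : ℚ) = W) : (C.u : ℚ) = 1 ∨ (C.u : ℚ) = -1 := by
  have hall : ∀ v : HeightOneSpectrum (𝓞 ℚ), v.valuation ℚ (C.u : ℚ) = 1 := by
    intro v
    have hℓP : (primesEquiv v : ℕ).Prime := (primesEquiv v).2
    by_cases hv2 : (primesEquiv v : ℕ) = 2
    · exact V.valuation_u_eq_one_of_smul_quadraticTwist_two_of_emod_four_eq_one v hv2 hd4 W C hC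
    by_cases hvd : ((primesEquiv v : ℕ) : ℤ) ∣ d
    · have h2 : ¬ ((primesEquiv v : ℕ) : ℤ) ^ 2 ∣ d := by
        intro h
        have hu : IsUnit ((primesEquiv v : ℕ) : ℤ) := hsq _ (by rwa [← sq])
        exact (Nat.prime_iff_prime_int.mp hℓP).not_unit hu
      exact V.valuation_u_eq_one_of_smul_quadraticTwist_of_semistable_of_dvd v hv2 hvd h2 (hV v hvd)
        W C hC
    · exact V.valuation_u_eq_one_of_smul_quadraticTwist_of_odd_of_not_dvd v hv2 hvd W C hC
  -- `u` and `u⁻¹` are integers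
  have hu : (C.u : ℚ) ∈ (algebraMap (𝓞 ℚ) ℚ).range :=
    HeightOneSpectrum.mem_integers_of_valuation_le_one ℚ (C.u : ℚ) (fun v => (hall v).le)
  have hui : (C.u : ℚ)⁻¹ ∈ (algebraMap (𝓞 ℚ) ℚ).range :=
    HeightOneSpectrum.mem_integers_of_valuation_le_one ℚ (C.u : ℚ)⁻¹
      (fun v => by rw [map_inv₀, hall v, inv_one])
  obtain ⟨y, hy⟩ := hu
  obtain ⟨yi, hyi⟩ := hui
  obtain ⟨U, hU⟩ : ∃ n : ℤ, (n : ℚ) = C.u :=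
    ⟨Rat.ringOfIntegersEquiv y, (Rat.ringOfIntegersEquiv_apply_coe y).trans hy⟩
  obtain ⟨Ui, hUi⟩ : ∃ n : ℤ, (n : ℚ) = (C.u : ℚ)⁻¹ :=
    ⟨Rat.ringOfIntegersEquiv yi, (Rat.ringOfIntegersEquiv_apply_coe yi).trans hyi⟩
  have hUU : Ui * U = 1 := by
    exact_mod_cast (show (Ui : ℚ) * U = 1 by rw [hU, hUi, inv_mul_cancel₀ (Units.ne_zero C.u)])
  rcases Int.eq_one_or_neg_one_of_mul_eq_one' hUU with ⟨-, h⟩ | ⟨-, h⟩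
  · left; rw [← hU, h]; simp
  · right; rw [← hU, h]; simp

/-- **Pal 2012, Thm. 3.2, case `d > 0`, with `ũ = 1` — PROVED.** For `V/ℚ` globally minimal, `d > 0`
square-free with `d ≡ 1 (mod 4)`, `V` good or multiplicative at every prime dividing `d`, and `W` any
globally minimal model of `V^{(d)}` (`C • V.quadraticTwist d = W`): `√d · Ω(W) = Ω(V)` (real periods,
all real components). [cite: Pal2012, Thm. 3.2 (case d > 0) with Prop. 2.5] -/
theorem sqrt_mul_realPeriodRat_eq_of_twist_of_pos_of_squarefree {d : ℤ} (hd : 0 < d)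
    (hd4 : d % 4 = 1) (hsq : Squarefree d)
    (hV : ∀ v : HeightOneSpectrum (𝓞 ℚ), ((primesEquiv v : ℕ) : ℤ) ∣ d →
      V.HasGoodReductionAt v ∨ V.HasMultiplicativeReductionAt v)
    (W : WeierstrassCurve ℚ) [W.IsGloballyMinimal] (C : VariableChange ℚ)
    (hC : C • V.quadraticTwist (d : ℚ) = W) :
    Real.sqrt (d : ℝ) * W.realPeriodRat = V.realPeriodRat := by
  have hdq : (0 : ℚ) < d := by exact_mod_cast hd
  have h1 := V.realPeriodRat_mul_sqrt_of_twist_of_pos hdq W C hC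
  have hu : |((C.u : ℚ) : ℝ)| = 1 := by
    rcases V.u_eq_one_or_eq_neg_one_of_smul_quadraticTwist_of_squarefree hd4 hsq hV W C hC
      with h | h
    · rw [h]; simp
    · rw [h]; simp
  rw [hu, one_mul, Rat.cast_intCast, mul_comm] at h1
  exact h1

/-- **Pal 2012, Thm. 3.2, case `d < 0`, with `ũ = 1` — PROVED.** For `V/ℚ` globally minimal, `d < 0`
square-free with `d ≡ 1 (mod 4)`, `V` good or multiplicative at every prime dividing `d`, and `W` any
globally minimal model of `V^{(d)}`: `Ω(W) · √(−d) = c_∞(W) · |Ω⁻(V)|` — Pal's "if `d < 0`, then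
`Ω(E^d) = (ũ/√d) c_∞(E^d) Ω⁻(E)` up to sign" with `ũ = 1` (`Ω = realPeriodRat` over all real
components, `c_∞ = numRealComponents` of `W ⊗ ℝ`, `|Ω⁻| = imaginaryPeriodRat`). From
`realPeriodRat_mul_sqrt_of_twist_of_neg` (`ImaginaryPeriod.lean`) and `u(C) = ±1`.
[cite: Pal2012, Thm. 3.2 (case d < 0) with Prop. 2.5, and p. 1514 (Ω⁻)] -/
theorem realPeriodRat_mul_sqrt_eq_of_twist_of_neg_of_squarefree {d : ℤ} (hd : d < 0)
    (hd4 : d % 4 = 1) (hsq : Squarefree d)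
    (hV : ∀ v : HeightOneSpectrum (𝓞 ℚ), ((primesEquiv v : ℕ) : ℤ) ∣ d →
      V.HasGoodReductionAt v ∨ V.HasMultiplicativeReductionAt v)
    (W : WeierstrassCurve ℚ) [W.IsGloballyMinimal] (C : VariableChange ℚ)
    (hC : C • V.quadraticTwist (d : ℚ) = W) :
    W.realPeriodRat * Real.sqrt (-(d : ℝ)) = (W.baseChange ℝ).numRealComponents * V.imaginaryPeriodRat := by
  have hdq : (d : ℚ) < 0 := by exact_mod_cast hd
  have h1 := V.realPeriodRat_mul_sqrt_of_twist_of_neg hdq W C hC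
  have hu : |((C.u : ℚ) : ℝ)| = 1 := by
    rcases V.u_eq_one_or_eq_neg_one_of_smul_quadraticTwist_of_squarefree hd4 hsq hV W C hC
      with h | h
    · rw [h]; simp
    · rw [h]; simp
  rw [hu, one_mul, Rat.cast_intCast] at h1
  exact h1

end General

end WeierstrassCurve

namespace Literature.NumberTheory.EllipticCurves.Pal2012

open WeierstrassCurve

/-- **Pal 2012, Thm. 3.2 + Prop. 2.5, case `d = p* = −p`, `p ≡ 3 (mod 4)`, `E` semistable at `p` —
PROVED** (the `d < 0` companion of `thm32_sqrt_mul_realPeriodRat_twist_eq_of_prime_one_mod_four`):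
for `V/ℚ` globally minimal with good or multiplicative reduction at a prime `p ≡ 3 (mod 4)` and `W`
a globally minimal model of `V^{(−p)}` (`C • V.quadraticTwist (−p) = W`):
`Ω(W) · √p = c_∞(W) · |Ω⁻(V)|`, i.e. Pal's `Ω(E^d) = (ũ/√d) c_∞(E^d) Ω⁻(E)` (up to sign) with
`d = −p`, `ũ = 1` (`u_p = 1` since `λ_{v_p} = 0 < 6`; `u₂ = 1` since `−p ≡ 1 mod 4`). This is the
period input of the BSD residual cell's V9 line at the `p ≡ 3 (mod 4)` additive pairs
(`Summits/BirchSwinnertonDyer/Rank1Residual/Additive/`), delivered as a theorem (no named fact).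
[cite: Pal2012, Thm. 3.2 (case d < 0) with Prop. 2.5 (pp. 1516–1517) and p. 1514 (Ω⁻)] -/
theorem realPeriodRat_mul_sqrt_eq_of_twist_neg_prime (V W : WeierstrassCurve ℚ) [V.IsElliptic]
    [V.IsGloballyMinimal] [W.IsElliptic] [W.IsGloballyMinimal] (p : ℕ) [Fact p.Prime]
    (hp4 : p % 4 = 3) (hV : V.HasGoodReductionAtPrime p ∨ V.HasMultiplicativeReductionAtPrime p)
    (hCW : ∃ C : VariableChange ℚ, C • V.quadraticTwist (-(p : ℚ)) = W) :
    W.realPeriodRat * Real.sqrt p = (W.baseChange ℝ).numRealComponents * V.imaginaryPeriodRat := by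
  obtain ⟨C, hC⟩ := hCW
  have hpP : p.Prime := Fact.out
  have hC' : C • V.quadraticTwist ((-(p : ℤ) : ℤ) : ℚ) = W := by
    rw [Int.cast_neg, Int.cast_natCast]; exact hC
  have hd : (-(p : ℤ) : ℤ) < 0 := by
    have := hpP.pos; omega
  have hd4 : (-(p : ℤ) : ℤ) % 4 = 1 := by omega
  have hsq : Squarefree (-(p : ℤ) : ℤ) :=
    (Nat.prime_iff_prime_int.mp hpP).neg.squarefree
  have hsst : ∀ v : HeightOneSpectrum (𝓞 ℚ), ((primesEquiv v : ℕ) : ℤ) ∣ (-(p : ℤ) : ℤ) →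
      V.HasGoodReductionAt v ∨ V.HasMultiplicativeReductionAt v := by
    intro v hv
    have hvp : (primesEquiv v : ℕ) = p :=
      (Nat.prime_dvd_prime_iff_eq (primesEquiv v).2 hpP).mp
        (Int.natCast_dvd_natCast.mp ((dvd_neg).mp hv))
    subst hvp
    rcases hV with h | h
    · exact Or.inl ((hasGoodReductionAtPrime_iff_hasGoodReductionAt_ringOfIntegers v V).mp h)
    · exact Or.inr
        ((V.hasMultiplicativeReductionAtPrime_iff_hasMultiplicativeReductionAt_ringOfIntegers v).mp h)
  have h1 := V.realPeriodRat_mul_sqrt_eq_of_twist_of_neg_of_squarefree hd hd4 hsq hsst W C hC'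
  rw [Int.cast_neg, Int.cast_natCast, neg_neg] at h1
  exact h1

end Literature.NumberTheory.EllipticCurves.Pal2012

end
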